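import Summits.CriticalPhenomena.SAWScalingLimit.Theorems.SAWDevelopingMapObservableToSLETypeLadderCarvedReductionSqueezeZonesSeq
import Summits.CriticalPhenomena.SAWScalingLimit.Theorems.SAWDevelopingMapObservableToSLETypeLadderCarvedReductionSqueezeLimitUnion
import HarnessLib

/-!
# The limit bulk `Ω` of the squeeze: the hypotheses of the inner contract and of the outer
# sequence (piece (T-A′₂F bulk facts) of stub T-A′₂F `stub_carvedReduction_squeezeGeometry_domainsCoreF`)

Crux `SAWDevelopingMap.ObservableToSLE` (stmt-CriticalPhenomena-10472), line `six-class-type-ladder`,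
stub T-A′₂F `stub_carvedReduction_squeezeGeometry_domainsCoreF`.  Landing target:
`Summits/CriticalPhenomena/SAWScalingLimit/Theorems/SAWDevelopingMapObservableToSLETypeLadderCarvedReductionSqueezeOmegaFacts.lean`.

`Ω := connectedComponentIn ((D - τ) ∖ X) b₀`, `X = X_S ∪ X_T` the unions of the closed limit
cells of the two sides (`sideStructure`), `b₀ = P₀ + (ρ/256) i` the base point of the `JoinedIn`
characterisation of the super-domain `E` (`superSup`).  `omegaFacts` assembles, from the side
structures, the bulk path (`bulkPath_joinedIn_of_eventually`), the cut structure of `E`, and the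
no-long-fingers region (`Squeeze.noLongFingers_domain`), everything the inner contract
`Squeeze.stub_carvedReduction_innerApproximant`, the hull `bulkHull` and `outerSeq` ask of `Ω`:
open, connected, containing both open upper half-windows, `Ω ⊆ E` (`bulk_subset_of_joinedIn`; the
cuts meet `D - τ` only inside `X`: low boxes and frames lie in the closed lower half-windows, body
zones in the body cores, exits off `closure (D - τ)`, ends off `J`), `IsConnected Ωᶜ`
(`isConnected_compl_bulk`), the far region inside `Ω` (`far_subset_bulk`), and
`frontier Ω ⊆ X ∪ frontier (D - τ)`.
Registered carrier: `stub_carvedReduction_omegaFacts`.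
-/

noncomputable section

open scoped Topology
open Filter Set Metric
open Literature.Probability.RandomPlanarGeometry

namespace Summit.CriticalPhenomena.SAWScalingLimit.Theorems.ObservableToSLE.TypeLadder

/-- The frame box lies in the closure of the open lower half-window of radius `ρ/2`. -/
theorem gateRect_subset_closure_lowerHalfWindow {P : ℂ} {ρ : ℝ} (hρ : 0 < ρ) :
    gateRect P ρ ⊆ closure ({z : ℂ | z.im < P.im} ∩ ball P (ρ / 2)) := by
  rintro z ⟨hre, h1, h2⟩
  rw [Metric.mem_closure_iff]
  intro ε hε
  set t : ℝ := min (ε / 2) (ρ / 8) with ht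
  have ht0 : 0 < t := lt_min (half_pos hε) (by positivity)
  refine ⟨z - ((t : ℝ) : ℂ) * Complex.I, ⟨?_, ?_⟩, ?_⟩
  · show (z - ((t : ℝ) : ℂ) * Complex.I).im < P.im
    simp; linarith
  · rw [mem_ball, dist_eq_norm]
    refine (Complex.norm_le_abs_re_add_abs_im _).trans_lt ?_
    have e1 : (z - ((t : ℝ) : ℂ) * Complex.I - P).re = z.re - P.re := by simp
    have e2 : (z - ((t : ℝ) : ℂ) * Complex.I - P).im = z.im - t - P.im := by simp
    rw [e1, e2]
    have : |z.im - t - P.im| ≤ ρ / 128 + t := by rw [abs_le]; constructor <;> linarith [min_le_right (ε / 2) (ρ / 8)]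
    linarith [min_le_right (ε / 2) (ρ / 8)]
  · rw [dist_eq_norm, sub_sub_cancel, norm_mul, Complex.norm_real, Complex.norm_I, mul_one, Real.norm_eq_abs, abs_of_pos ht0]
    linarith [min_le_left (ε / 2) (ρ / 8)]

/-- **THE LIMIT BULK**; see the module docstring. -/
theorem omegaFacts (D : DobrushinDomain) (τ : ℂ) {XS XT Uf E J : Set ℂ} {L F Bd : Fin 2 → Set ℂ}
    {xx : Fin 2 → Fin 2 → ℂ} {P : Fin 2 → ℂ} {ρ R rs : ℝ} (hρ : 0 < ρ)
    (hXSc : IsClosed XS) (hXTc : IsClosed XT) (hXS : IsConnected XS) (hXT : IsConnected XT)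
    (hα₀ : D.pt 0 - τ ∈ XS) (hα₁ : D.pt 1 - τ ∈ XT)
    (hXSR : XS ⊆ closedBall (D.pt 0 - τ) R) (hXTR : XT ⊆ closedBall (D.pt 1 - τ) R)
    (hPα : ∀ i, dist (P i) (D.pt i - τ) ≤ R) (hsep : 2 * (R + ρ) < dist (D.pt 0) (D.pt 1))
    (hupS : ∀ z : ℂ, dist z (P 0) < ρ / 2 → (P 0).im < z.im → z ∉ XS)
    (hupT : ∀ z : ℂ, dist z (P 1) < ρ / 2 → (P 1).im < z.im → z ∉ XT)
    (hballs : ∀ i, ball (P i) (ρ / 2) ⊆ closure ((fun z => z - τ) '' D.carrier))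
    (hpath : JoinedIn (((fun z => z - τ) '' D.carrier) \ (XS ∪ XT)) (P 0 + ((ρ / 4 : ℝ) : ℂ) * Complex.I)
      (P 1 + ((ρ / 4 : ℝ) : ℂ) * Complex.I))
    -- the super-domain
    (hDJ : closure ((fun z => z - τ) '' D.carrier) ⊆ J) (hJo : IsOpen J)
    (hjoinE : ∀ z : ℂ, JoinedIn (J \ (L 0 ∪ L 1)) z (P 0 + (((ρ / 128) / 2 : ℝ) : ℂ) * Complex.I) → z ∈ E)
    (hL : ∀ i, L i ⊆ gateO (Bd i) (F i) (P i) ρ ∪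
      (segment ℝ (P i - ((ρ / 64 : ℝ) : ℂ) - ((ρ / 128 : ℝ) : ℂ) * Complex.I) (P i - ((ρ / 64 : ℝ) : ℂ)) ∪
        segment ℝ (P i - ((ρ / 64 : ℝ) : ℂ)) (P i + ((ρ / 64 : ℝ) : ℂ)) ∪
        segment ℝ (P i + ((ρ / 64 : ℝ) : ℂ)) (P i + ((ρ / 64 : ℝ) : ℂ) - ((ρ / 128 : ℝ) : ℂ) * Complex.I)) ∪
      {xx i 0, xx i 1})
    (hxx : ∀ i k, xx i k ∈ frontier J) (hFD : ∀ i, Disjoint (closure (F i)) (closure ((fun z => z - τ) '' D.carrier)))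
    (hLHW : ∀ i, {z : ℂ | z.im < (P i).im} ∩ ball (P i) (ρ / 2) ⊆ (![XS, XT] i))
    (hbody : ∀ i, {z : ℂ | infDist z (Bd i) < ρ / 4} ⊆ (![XS, XT] i))
    -- the no-long-fingers region
    (hUf : IsPreconnected Uf) (hUfD : Uf ⊆ (fun z => z - τ) '' D.carrier)
    (hUfball : ∀ i, Disjoint Uf (closedBall (D.pt i - τ) R))
    (hUfbig : ((fun z => z - τ) '' D.carrier) \ (⋃ i, ball (D.pt i - τ) rs) ⊆ Uf)
    (hfarU : ∀ z ∈ (fun z => z - τ) '' D.carrier, dist z (D.pt 0 - τ) = rs → z ∈ Uf)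
    (hrs₀ : R + ρ ≤ rs) (hrs₁ : rs + R + ρ ≤ dist (D.pt 0) (D.pt 1)) :
    let Dτ : Set ℂ := (fun z => z - τ) '' D.carrier
    let Ω : Set ℂ := connectedComponentIn (Dτ \ (XS ∪ XT)) (P 0 + (((ρ / 128) / 2 : ℝ) : ℂ) * Complex.I)
    IsOpen Ω ∧ IsConnected Ω ∧ (∀ i, {z : ℂ | (P i).im < z.im} ∩ ball (P i) (ρ / 2) ⊆ Ω) ∧ Ω ⊆ E ∧
      IsConnected Ωᶜ ∧ Dτ \ (⋃ i : Fin 2, closedBall (D.pt i - τ) rs) ⊆ Ω ∧ Ω ⊆ closure Dτ ∧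
      frontier Ω ⊆ (XS ∪ XT) ∪ frontier Dτ ∧ P 0 + (((ρ / 128) / 2 : ℝ) : ℂ) * Complex.I ∈ Ω := by
  intro Dτ Ω
  set b₀ : ℂ := P 0 + (((ρ / 128) / 2 : ℝ) : ℂ) * Complex.I with hb₀def
  set X : Set ℂ := XS ∪ XT with hXdef
  have hDo : IsOpen Dτ := isOpen_translate D.toJordanDomain τ
  have hXc : IsClosed X := hXSc.union hXTc
  have hOo : IsOpen (Dτ \ X) := hDo.sdiff hXc
  have hαdist : dist (D.pt 0 - τ) (D.pt 1 - τ) = dist (D.pt 0) (D.pt 1) := dist_sub_right _ _ _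
  -- the windows miss the other side's cells
  have hwinX : ∀ i (z : ℂ), dist z (P i) < ρ / 2 → (P i).im < z.im → z ∉ X := by
    have key : ∀ (i : Fin 2) (z : ℂ), dist z (P i) < ρ / 2 → dist z (D.pt i - τ) < R + ρ / 2 := fun i z hz => by
      linarith [dist_triangle z (P i) (D.pt i - τ), hPα i]
    refine Fin.forall_fin_two.2 ⟨fun z hz hzim h => ?_, fun z hz hzim h => ?_⟩
    · rcases h with h | h
      · exact hupS z hz hzim h
      · have h1 := mem_closedBall.1 (hXTR h)
        have h2 := key 0 z hz
        linarith [dist_triangle (D.pt 0 - τ) z (D.pt 1 - τ), dist_comm z (D.pt 0 - τ), hαdist]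
    · rcases h with h | h
      · have h1 := mem_closedBall.1 (hXSR h)
        have h2 := key 1 z hz
        linarith [dist_triangle (D.pt 0 - τ) z (D.pt 1 - τ), dist_comm (D.pt 0 - τ) z, hαdist]
      · exact hupT z hz hzim h
  -- the open upper half-windows lie in `Dτ ∖ X`
  have hwinD : ∀ i, {z : ℂ | (P i).im < z.im} ∩ ball (P i) (ρ / 2) ⊆ Dτ \ X := fun i z hz =>
    ⟨ball_subset_translate_of_subset_closure D.toJordanDomain τ (hballs i) hz.2, hwinX i z (mem_ball.1 hz.2) hz.1⟩
  have hwinc : ∀ i, Convex ℝ ({z : ℂ | (P i).im < z.im} ∩ ball (P i) (ρ / 2)) := fun i =>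
    (convex_halfSpace_im_gt _).inter (convex_ball _ _)
  have hmemwin : ∀ (i : Fin 2) (t : ℝ), 0 < t → t < ρ / 2 → P i + ((t : ℝ) : ℂ) * Complex.I ∈ {z : ℂ | (P i).im < z.im} ∩ ball (P i) (ρ / 2) := by
    intro i t ht htρ
    refine ⟨?_, ?_⟩
    · show (P i).im < (P i + ((t : ℝ) : ℂ) * Complex.I).im
      simp; exact ht
    · rw [mem_ball, dist_eq_norm, add_sub_cancel_left, norm_mul, Complex.norm_real, Complex.norm_I, mul_one,
        Real.norm_eq_abs, abs_of_pos ht]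
      exact htρ
  have hb₀win : b₀ ∈ {z : ℂ | (P 0).im < z.im} ∩ ball (P 0) (ρ / 2) := hmemwin 0 _ (by positivity) (by linarith)
  have hb₀ : b₀ ∈ Ω := mem_connectedComponentIn (hwinD 0 hb₀win)
  -- (1), (2)
  have hΩo : IsOpen Ω := hOo.connectedComponentIn
  have hΩc : IsConnected Ω := ⟨⟨b₀, hb₀⟩, isPreconnected_connectedComponentIn⟩
  -- (3) the windows
  have hwin0 : {z : ℂ | (P 0).im < z.im} ∩ ball (P 0) (ρ / 2) ⊆ Ω := window_subset_bulk (hwinc 0).isPreconnected (hwinD 0) hb₀win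
  have hq0 : P 0 + ((ρ / 4 : ℝ) : ℂ) * Complex.I ∈ Ω := hwin0 (hmemwin 0 _ (by positivity) (by linarith))
  have hjoin01 : JoinedIn (Dτ \ X) b₀ (P 1 + ((ρ / 4 : ℝ) : ℂ) * Complex.I) := by
    refine JoinedIn.trans ?_ hpath
    exact JoinedIn.of_segment_subset (((hwinc 0).segment_subset hb₀win (hmemwin 0 _ (by positivity) (by linarith))).trans (hwinD 0))
  have hwin1 : {z : ℂ | (P 1).im < z.im} ∩ ball (P 1) (ρ / 2) ⊆ Ω :=
    window_subset_bulk_of_joinedIn (hwinc 1).isPreconnected (hwinD 1) (hmemwin 1 _ (by positivity) (by linarith)) hjoin01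
  have hwin : ∀ i, {z : ℂ | (P i).im < z.im} ∩ ball (P i) (ρ / 2) ⊆ Ω := Fin.forall_fin_two.2 ⟨hwin0, hwin1⟩
  -- (4) `Ω ⊆ E`: the cuts meet `Dτ` only inside `X`
  have hDJ' : Dτ ⊆ J := subset_closure.trans hDJ
  have hside : ∀ i, (![XS, XT] i : Set ℂ) ⊆ X := Fin.forall_fin_two.2 ⟨subset_union_left, subset_union_right⟩
  have hsideC : ∀ i, IsClosed (![XS, XT] i : Set ℂ) := Fin.forall_fin_two.2 ⟨hXSc, hXTc⟩
  have hcut : (L 0 ∪ L 1) ∩ Dτ ⊆ X := by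
    have key : ∀ i, L i ∩ Dτ ⊆ X := by
      intro i z ⟨hzL, hzD⟩
      rcases hL i hzL with (hO | hfr) | hx
      · rcases hO with (⟨hlow, -⟩ | hbd) | hFi
        · refine hside i (hLHW i ?_)
          have := lowBox_subset_lowerWin (P := P i) hρ (show (0 : ℝ) ≤ ρ / 256 by positivity) hlow
          obtain ⟨h1, h2⟩ := this
          refine ⟨?_, ?_⟩
          · have : z.im < (P i).im - 0 := h1; simpa using this
          · simpa using h2
        · refine hside i (hbody i ?_)
          have : infDist z (Bd i) < ρ / 8 := hbd
          show infDist z (Bd i) < ρ / 4; linarith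
        · exact absurd (subset_closure hzD) (disjoint_left.1 (hFD i) (subset_closure hFi))
      · have h1 := frame_subset_rect (g := P i) (ρ' := ρ / 64) (h := ρ / 128) (by positivity) (by positivity) hfr
        have h2 : z ∈ gateRect (P i) ρ := h1
        have h3 := gateRect_subset_closure_lowerHalfWindow hρ h2
        exact hside i ((hsideC i).closure_subset_iff.2 (hLHW i) h3)
      · have hzfr : z ∈ frontier J := by
          rcases hx with rfl | rfl
          · exact hxx i 0
          · exact hxx i 1
        exact absurd (hDJ' hzD) (fun h => hzfr.2 (by rwa [hJo.interior_eq]))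
    rintro z ⟨hz | hz, hzD⟩
    · exact key 0 ⟨hz, hzD⟩
    · exact key 1 ⟨hz, hzD⟩
  have hΩE : Ω ⊆ E := bulk_subset_of_joinedIn hDo hXc hDJ' hcut hb₀ hjoinE
  -- (5) connected complement
  have hpt : ∀ i, D.pt i - τ ∈ Dτᶜ := fun i => boundary_sub_not_mem_translate D.toJordanDomain τ (D.mark i)
  have hΩcc : IsConnected Ωᶜ :=
    isConnected_compl_bulk hDo hXc (isConnected_compl_union (isPreconnected_compl_translate D.toJordanDomain τ) (hpt 0) (hpt 1)
      hXS hXT hα₀ hα₁) (fun O b hO hOc => isConnected_compl_connectedComponentIn hO hOc b) b₀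
  -- (6) the far region
  have hUfX : Disjoint Uf X := by
    rw [disjoint_left]
    rintro z hz (h | h)
    · exact disjoint_left.1 (hUfball 0) hz (hXSR h)
    · exact disjoint_left.1 (hUfball 1) hz (hXTR h)
  have hd₀ : dist b₀ (D.pt 0 - τ) ≤ rs := by
    have h1 : dist b₀ (P 0) = (ρ / 128) / 2 := by
      rw [hb₀def, dist_eq_norm, add_sub_cancel_left, norm_mul, Complex.norm_real, Complex.norm_I, mul_one, Real.norm_eq_abs,
        abs_of_pos (by positivity)]
    linarith [dist_triangle b₀ (P 0) (D.pt 0 - τ), hPα 0]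
  have hd₁ : rs ≤ dist (P 1 + ((ρ / 4 : ℝ) : ℂ) * Complex.I) (D.pt 0 - τ) := by
    have h1 : dist (P 1 + ((ρ / 4 : ℝ) : ℂ) * Complex.I) (P 1) = ρ / 4 := by
      rw [dist_eq_norm, add_sub_cancel_left, norm_mul, Complex.norm_real, Complex.norm_I, mul_one, Real.norm_eq_abs,
        abs_of_pos (by positivity)]
    have h2 := dist_triangle (D.pt 0 - τ) (P 1 + ((ρ / 4 : ℝ) : ℂ) * Complex.I) (D.pt 1 - τ)
    have h3 := dist_triangle (P 1 + ((ρ / 4 : ℝ) : ℂ) * Complex.I) (P 1) (D.pt 1 - τ)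
    rw [dist_comm (D.pt 0 - τ) (P 1 + ((ρ / 4 : ℝ) : ℂ) * Complex.I)] at h2
    linarith [hPα 1]
  have hUfΩ : Uf ⊆ Ω := far_subset_bulk hUf hUfD hUfX hfarU hjoin01 hd₀ hd₁
  have hfar : Dτ \ (⋃ i : Fin 2, closedBall (D.pt i - τ) rs) ⊆ Ω := by
    refine subset_trans (fun z hz => hUfbig ⟨hz.1, fun h => hz.2 ?_⟩) hUfΩ
    obtain ⟨i, hi⟩ := mem_iUnion.1 h
    exact mem_iUnion.2 ⟨i, ball_subset_closedBall hi⟩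
  -- (7), (8)
  have hΩD : Ω ⊆ Dτ := fun z hz => (connectedComponentIn_subset _ _ hz).1
  have hfrΩ : frontier Ω ⊆ X ∪ frontier Dτ := by
    intro p hp
    have h1 := frontier_component_subset_compl hOo b₀ hp
    by_cases hpX : p ∈ X
    · exact Or.inl hpX
    · refine Or.inr ⟨closure_mono hΩD (frontier_subset_closure hp), fun h => h1 ⟨?_, hpX⟩⟩
      rwa [hDo.interior_eq] at h
  exact ⟨hΩo, hΩc, hwin, hΩE, hΩcc, hfar, hΩD.trans subset_closure, hfrΩ, hb₀⟩

/-- **Registered carrier `stub_carvedReduction_omegaFacts`** (crux item stmt-CriticalPhenomena-10472,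
stub T-A′₂F `stub_carvedReduction_squeezeGeometry_domainsCoreF`, piece THE BULK FACTS): the frame
box lies in the closure of the open lower half-window. -/
theorem stub_carvedReduction_omegaFacts :
    ∀ (P : ℂ) (ρ : ℝ), 0 < ρ → gateRect P ρ ⊆ closure ({z : ℂ | z.im < P.im} ∩ ball P (ρ / 2)) :=
  fun _ _ hρ => gateRect_subset_closure_lowerHalfWindow hρ

end Summit.CriticalPhenomena.SAWScalingLimit.Theorems.ObservableToSLE.TypeLadder

end
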